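import Summits.QuantumFields.BalabanUV.Beta.FP.NestedStepLawTorusCompositeOneShotTop
import Summits.QuantumFields.BalabanUV.Beta.FP.NestedDeadRowsOrderTwoTower

/-!
# `BalabanUV.Beta.FP.NestedDeadRowsOrderTwoTowerClosed` — road «FP» for binder row D1, ROUTE T, (β-dead) ORDER 2 AT THE COMPOSITE DOOR #21 (`j ≥ 2`):
# **THE TWO KKT NON-DEGENERACIES OF #21 EXPORTED, AND #21's `uTop` SLOT CLOSED WITH NO HYPOTHESIS BEYOND #21's OWN BINDERS** (the OWNER d1-p3 g26's junction
# K-21, journal `HOME/CLAIMS.log` l.51912: «what do §2's `h₁ h₂` cost at the `j ≥ 2` assembly» — answer: NOTHING, they are #21's own internal `h1 ∕ h2`, here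
# made theorems)

WHY.  My `NestedDeadRowsOrderTwoTower` (p359666 ✓) closes #21 `NestedStepLawTorusCompositeOneShotTop`'s ONE slice-side letter `uTop` for the nested composite
column of any top direction GIVEN the two KKT non-degeneracies `h₁ : IsUnit (kkt H₀ (fromRows Q₁₀ τ₁)).det` (finest form, composite averaging, the one-shot big
comb of the tower below — R-FP-55 (α)) and `h₂ : IsUnit (kkt S₁₁ (fromRows Q₂₀ τ₂)).det` (the effective coarse form, the top step's averaging, the top comb).
#21 PROVES both INSIDE its proof (`h1` by leaf-05's nested (INV) `torus_composite_inv_and_eff` transferred ACROSS THE SLICE CHANGE by an2's Literature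
`GaugeFixingPropagators.isUnit_det_kkt_sliceChange₃`, the transversalities being my lineage's `det_nestedSlice_mul_towerGen_ne_zero` ∕ `det_bigP_mul_towerGen_ne_zero`;
`h2` by `blocks_sliceChange₃` + leaf-05's (EFF) + `RelInvPeriodisedCombRows.torus_isUnit_det_kkt_combRows`) but does not EXPORT them.  THIS FILE exports them at
#21's letters (§1) and composes (§2): #21's `uTop` at leaf-02 I-5's `D̄₂` letter for the nested composite column of ANY top direction, with NO hypothesis beyond
#21's own presentation binders — the `j ≥ 2` assembly's `uTop :=` is ONE term with nothing left displayed.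
* §1 **`torus_kkt_nondeg_tower`** (#21's binders `hrs hlev hM′ pμ′ mμ′ hfμ′ hcoarse′ hH₀ hQ₁₀ hτ₁ hτ₂ hQ₂₀` VERBATIM):
  `IsUnit (kkt H₀ (fromRows Q₁₀ τ₁)).det ∧ IsUnit (kkt (effForm H₀ (fromRows Q₁₀ τ₁)).toBlocks₁₁ (fromRows Q₂₀ τ₂)).det ∧ (effForm H₀ (fromRows Q₁₀ τ₁)).toBlocks₁₁ =
  (∏_{i<n+1} (wVH d Lc (lev i))⁻¹) • H₀^{M′}` (the (EFF-m) identity across the slice change, #21's `hEff ∘ hIE.2`) — #21's proof lines, transplanted.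
* §2 **`torus_uTop_tower_closed`**: with `h := minOp H₀ (fromRows Q₁₀ τ₁) *ᵥ Sum.elim (minOp (effForm H₀ (fromRows Q₁₀ τ₁)).toBlocks₁₁ (fromRows Q₂₀ τ₂) *ᵥ Sum.elim h̄ 0) 0`
  (the nested composite column of the top direction `h̄ : κ → ℝ`), `Db₁ :=` C2's `D̄₁`, `Db₂ :=` I-5's `D̄₂` (both along `h`), #21's `hτ₂ hDbar`:
  `secondVar (τ₂ * Dbar) (τ₂ * Db₁) (τ₂ * Db₂) = 0` — `NestedDeadRowsOrderTwoTower.torus_uTop_tower_of_c2_letter_nested_column` fed by §1.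
[folklore] composition BY NAME; no `def`, no `def … : Prop`, nothing cited, 0 sorry.  AS CANDIDATE under the (♭) `compIns₂` exactly as `NestedDeadRowsOrderTwoTower`
(the cut-(A) branch keeps its priced form there, §4; the label is PART THREE's junction's).  NOT HERE: anything of #21's conclusion, the rows `c2 ∕ d2` (leaf-02
I-5), anything of the dictionary.

HONEST DEPENDENCY (page 1, mandatory): continuum YM on T⁴ ⇐ BetaPertH ∧ nine spine estimates (0/9 proved); BetaPertH ⇐ (D1) ∧ (D4) ∧ CAP+tail;
G-an2-4 gates asym, D1 and NE2/3/4.  HONEST FRAMING (cell contract, verbatim): «discharging `BetaPertH` makes Bałaban's UV stability UNCONDITIONAL —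
a real constructive-QFT result; it is NOT the continuum limit and NOT the Clay problem.»  ABSOLUTE RULE (cell charter, verbatim): «No internally-minted
statement may enter as a cited fact. Every hypothesis is either kernel-proved in this package or a verbatim quotation of a PUBLISHED theorem with page
reference. The manuscript(s) under audit are NOT citable for their own disputed steps — they are the thing under adjudication; programme-internal
(2001/route/tribunal) claims are never citable.»  0 estimates; 0∕4 row-D1 binders (hW, hR, D1Tel, D1Rep); NOT (T-ID)∕(T-β) complete, NOT SDF, NOT D1,
NOT BetaPertH, NOT continuum, NOT Clay.  «not in print; our bookkeeping».
Provenance: D1 formalisation swarm LEAF PROVER 06, unit b2b-balaban-beta-d1-formalise-leaf-06 gen 27, 2026-08-23.  No existing file touched.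
-/

noncomputable section

open scoped BigOperators Matrix

namespace Summit.QuantumFields.BalabanUV.Beta.FP.NestedDeadRowsOrderTwoTowerClosed

open Matrix Finset
open Literature.Probability.LatticeModels (Torus.proj)
open Literature.MathematicalPhysics.QuantumFieldTheory.Balaban1983to89
open Literature.MathematicalPhysics.QuantumFieldTheory.Balaban1983to89.Beta
open Literature.MathematicalPhysics.QuantumFieldTheory.Balaban1983to89.Beta.Composition (kkt)
open Literature.MathematicalPhysics.QuantumFieldTheory.Balaban1983to89.Beta.CompositionSingular (effForm minOp)
open Literature.MathematicalPhysics.QuantumFieldTheory.Balaban1983to89.Beta.GaugeFixingPropagators (isUnit_det_kkt_sliceChange₃ blocks_sliceChange₃)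
open BalabanStepJetsSucc (wVH)
open B5Prop11Plancherel (fine)
open B6Lemma24Torus (pbox)
open AffineAveraging (Site box toSite unitVec)
open OneStepResolventKernel (Fib)
open Summit.QuantumFields.BalabanUV.Beta.BorderedHessian (bhKStepAt stepScale)
open Summit.QuantumFields.BalabanUV.Beta.D1BFx.LogDetSecondVariation (secondVar)
open Summit.QuantumFields.BalabanUV.Beta.FP.KernelPeriodisationFib (Idx perF)
open Summit.QuantumFields.BalabanUV.Beta.FP.TorusCombRows (Res)
open Summit.QuantumFields.BalabanUV.Beta.FP.TorusGaugeCovariance (tgrad tdelta)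
open Summit.QuantumFields.BalabanUV.Beta.FP.TorusCompositeObjects (towerTorus compRows nestedSlice NParam combF bigP towerGen)
open Summit.QuantumFields.BalabanUV.Beta.FP.TorusCompositeUnimodular (det_bigP_mul_towerGen_ne_zero)
open Summit.QuantumFields.BalabanUV.Beta.FP.TorusCompositeSlice (det_nestedSlice_mul_towerGen_ne_zero)
open Summit.QuantumFields.BalabanUV.Beta.FP.TorusCompositeCovariance (compRows_mul_towerGen_succ)
open Summit.QuantumFields.BalabanUV.Beta.FP.TorusEffFormComposite (torus_composite_inv_and_eff)
open Summit.QuantumFields.BalabanUV.Beta.FP.RelInvPeriodisedCoarse (det_kkt_smul_form_ne_zero_iff)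
open Summit.QuantumFields.BalabanUV.Beta.FP.RelInvPeriodisedCombRows (torus_isUnit_det_kkt_combRows)
open Summit.QuantumFields.BalabanUV.Beta.FP.RelInvPeriodisedEffFormCoarse (wVH_pos)
open Summit.QuantumFields.BalabanUV.Beta.FP.NestedStepLawTorusInstance (dvd_fine)
open Summit.QuantumFields.BalabanUV.Beta.FP.NestedStepLawTorusComposite (H₀_transpose_of_dvd dvd_towerTorus_succ)
open Summit.QuantumFields.BalabanUV.Beta.FP.NestedStepLawTorusCompositeOneShot (torus_a0_tower)
open Summit.QuantumFields.BalabanUV.Beta.GAN24.FineReadoutCauchyFrame (toSite_mem_range)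
open Summit.QuantumFields.BalabanUV.Beta.FP.NestedDeadRowsOrderTwoTower (torus_uTop_tower_of_c2_letter_nested_column)

variable {d : ℕ} (M' : Fin (d + 1) → ℕ) [∀ μ, NeZero (M' μ)] (Lc : ℕ) [NeZero Lc] (lev : ℕ → ℕ) (rs : ℕ → (Fin (d + 1) → ℕ)) (n : ℕ)

/-! ## §1 #21's two KKT non-degeneracies, exported at #21's letters -/

set_option synthInstance.maxSize 1024 in
/-- [folklore] **`torus_kkt_nondeg_tower` — #21's INTERNAL `h1` AND `h2`, AS A THEOREM.**  At #21 `NestedStepLawTorusCompositeOneShotTop`'s binders (`hrs hlev hM′`,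
the top multipliers' presentation `pμ′ mμ′ hfμ′ hcoarse′`, the pins `hH₀ hQ₁₀ hτ₁ hτ₂ hQ₂₀` VERBATIM): the finest system `(H₀, [compRows; τ₁])` on the ONE-SHOT
fine slice and the top system `((effForm …).toBlocks₁₁, [Q₂₀; combF])` are KKT-non-degenerate, AND the effective coarse form on the one-shot slice IS
`(∏_{i<n+1} (wVH d Lc (lev i))⁻¹) •` the level-`(lev 0)` torus form on `M′` (the (EFF-m) identity #21 uses but does not export).  #21's proof lines transplanted: leaf-05's nested (INV)∕(EFF)
`torus_composite_inv_and_eff`, an2's slice change `isUnit_det_kkt_sliceChange₃` ∕ `blocks_sliceChange₃` (transversalities `det_nestedSlice_mul_towerGen_ne_zero` ∕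
`det_bigP_mul_towerGen_ne_zero`, the lower generators killed by `H₀` (`torus_a0_tower`) and by `compRows` (`compRows_mul_towerGen_succ`)), and leaf-05's
`torus_isUnit_det_kkt_combRows` through `det_kkt_smul_form_ne_zero_iff`. -/
theorem torus_kkt_nondeg_tower (hrs : ∀ k, rs k ∈ box (d + 1) Lc) (hlev : ∀ i, lev i = lev (i + 1) + 1) (hM' : ∀ i, Lc ∣ M' i)
    {κ : Type*} [Fintype κ] [DecidableEq κ] (pμ' : κ → ↥(pbox M')) (mμ' : κ → Fin (d + 1))
    (hfμ' : Function.Injective (fun a : κ => ((pμ' a, Sum.inr (mμ' a)) : Idx M' (Fib d))))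
    (hcoarse' : ∀ (s : ↥(pbox M')) (m : Fin (d + 1)),
      ((s, Sum.inr m) : Idx M' (Fib d)) ∈ Set.range (fun a : κ => ((pμ' a, Sum.inr (mμ' a)) : Idx M' (Fib d))) ↔ Torus.proj Lc (s : Site (d + 1)) = 0)
    {H₀ : Matrix (↥(pbox (towerTorus Lc M' (n + 1))) × Fin (d + 1)) (↥(pbox (towerTorus Lc M' (n + 1))) × Fin (d + 1)) ℝ}
    {Q₁₀ : Matrix (↥(pbox M') × Fin (d + 1)) (↥(pbox (towerTorus Lc M' (n + 1))) × Fin (d + 1)) ℝ}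
    {τ₁ : Matrix (NParam Lc (fine Lc M') (fun k => rs (k + 1)) n) (↥(pbox (towerTorus Lc M' (n + 1))) × Fin (d + 1)) ℝ}
    (hH₀ : H₀ = (perF (towerTorus Lc M' (n + 1)) (bhKStepAt d (toSite (rs (n + 1))) Lc (lev (n + 1)))).submatrix
        (fun b : ↥(pbox (towerTorus Lc M' (n + 1))) × Fin (d + 1) => ((b.1, Sum.inl b.2) : Idx (towerTorus Lc M' (n + 1)) (Fib d)))
        (fun b : ↥(pbox (towerTorus Lc M' (n + 1))) × Fin (d + 1) => ((b.1, Sum.inl b.2) : Idx (towerTorus Lc M' (n + 1)) (Fib d))))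
    (hQ₁₀ : Q₁₀ = compRows Lc M' lev rs (n + 1))
    (hτ₁ : τ₁ = bigP Lc (fine Lc M') (fun k => rs (k + 1)) (fun k => toSite_mem_range (hrs (k + 1))) n)
    {τ₂ : Matrix (Res (toSite (rs 0)) Lc M') (↥(pbox M') × Fin (d + 1)) ℝ} (hτ₂ : τ₂ = combF Lc M' (rs 0))
    {Q₂₀ : Matrix κ (↥(pbox M') × Fin (d + 1)) ℝ}
    (hQ₂₀ : Q₂₀ = (perF M' (bhKStepAt d (toSite (rs 0)) Lc (lev 0))).submatrix (fun a : κ => ((pμ' a, Sum.inr (mμ' a)) : Idx M' (Fib d)))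
        (fun b : ↥(pbox M') × Fin (d + 1) => ((b.1, Sum.inl b.2) : Idx M' (Fib d)))) :
    IsUnit (kkt H₀ (fromRows Q₁₀ τ₁)).det ∧ IsUnit (kkt (effForm H₀ (fromRows Q₁₀ τ₁)).toBlocks₁₁ (fromRows Q₂₀ τ₂)).det
      ∧ (effForm H₀ (fromRows Q₁₀ τ₁)).toBlocks₁₁
          = (∏ i ∈ range (n + 1), (wVH d Lc (lev i))⁻¹) • (perF M' (bhKStepAt d (toSite (rs 0)) Lc (lev 0))).submatrix
              (fun b : ↥(pbox M') × Fin (d + 1) => ((b.1, Sum.inl b.2) : Idx M' (Fib d)))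
              (fun b : ↥(pbox M') × Fin (d + 1) => ((b.1, Sum.inl b.2) : Idx M' (Fib d))) := by
  have hL0 : 0 < Lc := Nat.pos_of_ne_zero (NeZero.ne Lc)
  -- the tower's generators (the door's `W₀`): killed by `H₀` ((WARD-m) order 0) and by `Q₁₀` up to the top block ((COV-m) order 0)
  obtain ⟨W₀, hW₀⟩ : ∃ W₀ : Matrix (↥(pbox (towerTorus Lc M' (n + 1))) × Fin (d + 1)) (NParam Lc M' rs (n + 1)) ℝ, W₀ = towerGen Lc M' rs (n + 1) := ⟨_, rfl⟩
  have a0 : H₀ * W₀ = 0 := torus_a0_tower Lc M' lev rs n hrs hH₀ hW₀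
  have c0 : Q₁₀ * W₀ = fromCols
      ((∏ i ∈ range (n + 1), (stepScale d Lc (lev (i + 1)) * ((box (d + 1) Lc).card : ℝ))) •
        (tgrad M').submatrix (fun a : ↥(pbox M') × Fin (d + 1) => ((a.1, Sum.inl a.2) : Idx M' (Fib d))) (fun t : Res (toSite (rs 0)) Lc M' => (t.1 : ↥(pbox M'))))
      (0 : Matrix (↥(pbox M') × Fin (d + 1)) (NParam Lc (fine Lc M') (fun k => rs (k + 1)) n) ℝ) := by
    rw [hQ₁₀, hW₀]; exact compRows_mul_towerGen_succ Lc n M' lev rs hrs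
  -- `H₀ᵀ = H₀` at the finest level; leaf-05's nested (INV) ∧ (EFF)
  have hH₀t : H₀ᵀ = H₀ := H₀_transpose_of_dvd (dvd_towerTorus_succ (Lc := Lc) M' n) (lev (n + 1)) hH₀
  have hIE := torus_composite_inv_and_eff Lc n M' lev rs hlev hrs
  -- the NESTED slice and the LOWER generators, NAMED at the call's index types
  obtain ⟨τn, hτn⟩ : ∃ τn : Matrix (NParam Lc (fine Lc M') (fun k => rs (k + 1)) n) (↥(pbox (towerTorus Lc M' (n + 1))) × Fin (d + 1)) ℝ,
      τn = nestedSlice Lc (fine Lc M') (fun k => lev (k + 1)) (fun k => rs (k + 1)) n := ⟨_, rfl⟩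
  obtain ⟨Wl, hWl⟩ : ∃ Wl : Matrix (↥(pbox (towerTorus Lc M' (n + 1))) × Fin (d + 1)) (NParam Lc (fine Lc M') (fun k => rs (k + 1)) n) ℝ,
      Wl = towerGen Lc (fine Lc M') (fun k => rs (k + 1)) n := ⟨_, rfl⟩
  have hW2 : W₀.toCols₂ = Wl := by
    rw [hWl, hW₀]
    exact Matrix.toCols₂_fromCols _ _
  have hKW : H₀ * Wl = 0 := by
    have h0 : H₀ * Matrix.fromCols W₀.toCols₁ W₀.toCols₂ = 0 := by rw [Matrix.fromCols_toCols]; exact a0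
    rw [Matrix.mul_fromCols, ← Matrix.fromCols_zero] at h0
    rw [← hW2]
    exact (Matrix.fromCols_inj h0).2
  have hKtW : H₀ᵀ * Wl = 0 := by rw [hH₀t]; exact hKW
  have hQW : Q₁₀ * Wl = 0 := by
    have h0 : Q₁₀ * Matrix.fromCols W₀.toCols₁ W₀.toCols₂
        = Matrix.fromCols
            ((∏ i ∈ range (n + 1), (stepScale d Lc (lev (i + 1)) * ((box (d + 1) Lc).card : ℝ))) •
              (tgrad M').submatrix (fun a : ↥(pbox M') × Fin (d + 1) => ((a.1, Sum.inl a.2) : Idx M' (Fib d)))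
                (fun t : Res (toSite (rs 0)) Lc M' => (t.1 : ↥(pbox M'))))
            (0 : Matrix (↥(pbox M') × Fin (d + 1)) (NParam Lc (fine Lc M') (fun k => rs (k + 1)) n) ℝ) := by
      rw [Matrix.fromCols_toCols]; exact c0
    rw [Matrix.mul_fromCols] at h0
    rw [← hW2]
    exact (Matrix.fromCols_inj h0).2
  -- transversal to both slices
  have hT : (τn * Wl).det ≠ 0 := by
    rw [hτn, hWl]
    exact det_nestedSlice_mul_towerGen_ne_zero Lc n (fine Lc M') (fun k => lev (k + 1)) (fun k => rs (k + 1)) (fun k => hrs (k + 1)) (dvd_fine M')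
  have hSW : (τ₁ * Wl).det ≠ 0 := by
    rw [hτ₁, hWl]
    exact det_bigP_mul_towerGen_ne_zero Lc (fine Lc M') (fun k => rs (k + 1)) (fun k => toSite_mem_range (hrs (k + 1))) (dvd_fine M') n
  -- leaf-05's nested (INV)
  have hτn1 : (kkt H₀ (fromRows Q₁₀ τn)).det ≠ 0 := by
    rw [hH₀, hQ₁₀, hτn]; exact hIE.1
  -- (INV) ∧ (EFF) ACROSS THE SLICE CHANGE (an2's Literature `GaugeFixingPropagators` §3c)
  have h1 : IsUnit (kkt H₀ (fromRows Q₁₀ τ₁)).det :=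
    isUnit_det_kkt_sliceChange₃ H₀ Q₁₀ τn τ₁ Wl hKW hKtW hQW (isUnit_iff_ne_zero.2 hT) (isUnit_iff_ne_zero.2 hSW)
      (isUnit_iff_ne_zero.2 hτn1)
  have hEff : (effForm H₀ (fromRows Q₁₀ τ₁)).toBlocks₁₁ = (effForm H₀ (fromRows Q₁₀ τn)).toBlocks₁₁ := by
    rw [(blocks_sliceChange₃ H₀ Q₁₀ τn τ₁ Wl hKW hKtW hQW (isUnit_iff_ne_zero.2 hT) (isUnit_iff_ne_zero.2 hSW)
      (isUnit_iff_ne_zero.2 hτn1)).2.2.2, toBlocks_fromBlocks₁₁]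
  have hc : (∏ i ∈ range (n + 1), (wVH d Lc (lev i))⁻¹) ≠ 0 :=
    prod_ne_zero_iff.mpr fun i _ => inv_ne_zero (wVH_pos hL0 (lev i)).ne'
  have hEff' : (effForm H₀ (fromRows Q₁₀ τ₁)).toBlocks₁₁
      = (∏ i ∈ range (n + 1), (wVH d Lc (lev i))⁻¹) • (perF M' (bhKStepAt d (toSite (rs 0)) Lc (lev 0))).submatrix
          (fun b : ↥(pbox M') × Fin (d + 1) => ((b.1, Sum.inl b.2) : Idx M' (Fib d)))
          (fun b : ↥(pbox M') × Fin (d + 1) => ((b.1, Sum.inl b.2) : Idx M' (Fib d))) := by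
    rw [hEff, hH₀, hQ₁₀, hτn]; exact hIE.2 (rs 0)
  have h2 : (kkt (effForm H₀ (fromRows Q₁₀ τ₁)).toBlocks₁₁ (fromRows Q₂₀ τ₂)).det ≠ 0 := by
    rw [hEff', hQ₂₀, hτ₂, det_kkt_smul_form_ne_zero_iff hc]
    exact (torus_isUnit_det_kkt_combRows M' (hrs 0) hM' (lev 0) _ hfμ' (fun a => ⟨mμ' a, rfl⟩) hcoarse').ne_zero
  exact ⟨h1, isUnit_iff_ne_zero.2 h2, hEff'⟩

/-! ## §2 #21's `uTop` slot CLOSED: no hypothesis beyond #21's own binders -/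

set_option synthInstance.maxSize 1024 in
/-- [folklore] **`torus_uTop_tower_closed` — #21's `uTop` FOR THE NESTED COMPOSITE COLUMN OF ANY TOP DIRECTION, NOTHING DISPLAYED.**  At #21's binders (as §1)
plus #21's `hDbar`, and with leaf-02 C2 ∕ I-5's composite covariance images `D̄₁ ∕ D̄₂` along `h` (their letters VERBATIM): for every top direction `h̄ : κ → ℝ`,
with `h :=` the nested composite column `minOp H₀ [Q₁₀; τ₁]·(minOp (effForm H₀ [Q₁₀; τ₁])₁₁ [Q₂₀; τ₂]·(h̄, 0), 0)`,
`secondVar (τ₂ * Dbar) (τ₂ * Db₁) (τ₂ * Db₂) = 0` — `NestedDeadRowsOrderTwoTower.torus_uTop_tower_of_c2_letter_nested_column` with `h₁ h₂ := §1`. -/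
theorem torus_uTop_tower_closed (hrs : ∀ k, rs k ∈ box (d + 1) Lc) (hlev : ∀ i, lev i = lev (i + 1) + 1) (hM' : ∀ i, Lc ∣ M' i)
    {κ : Type*} [Fintype κ] [DecidableEq κ] (pμ' : κ → ↥(pbox M')) (mμ' : κ → Fin (d + 1))
    (hfμ' : Function.Injective (fun a : κ => ((pμ' a, Sum.inr (mμ' a)) : Idx M' (Fib d))))
    (hcoarse' : ∀ (s : ↥(pbox M')) (m : Fin (d + 1)),
      ((s, Sum.inr m) : Idx M' (Fib d)) ∈ Set.range (fun a : κ => ((pμ' a, Sum.inr (mμ' a)) : Idx M' (Fib d))) ↔ Torus.proj Lc (s : Site (d + 1)) = 0)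
    {H₀ : Matrix (↥(pbox (towerTorus Lc M' (n + 1))) × Fin (d + 1)) (↥(pbox (towerTorus Lc M' (n + 1))) × Fin (d + 1)) ℝ}
    {Q₁₀ : Matrix (↥(pbox M') × Fin (d + 1)) (↥(pbox (towerTorus Lc M' (n + 1))) × Fin (d + 1)) ℝ}
    {τ₁ : Matrix (NParam Lc (fine Lc M') (fun k => rs (k + 1)) n) (↥(pbox (towerTorus Lc M' (n + 1))) × Fin (d + 1)) ℝ}
    (hH₀ : H₀ = (perF (towerTorus Lc M' (n + 1)) (bhKStepAt d (toSite (rs (n + 1))) Lc (lev (n + 1)))).submatrix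
        (fun b : ↥(pbox (towerTorus Lc M' (n + 1))) × Fin (d + 1) => ((b.1, Sum.inl b.2) : Idx (towerTorus Lc M' (n + 1)) (Fib d)))
        (fun b : ↥(pbox (towerTorus Lc M' (n + 1))) × Fin (d + 1) => ((b.1, Sum.inl b.2) : Idx (towerTorus Lc M' (n + 1)) (Fib d))))
    (hQ₁₀ : Q₁₀ = compRows Lc M' lev rs (n + 1))
    (hτ₁ : τ₁ = bigP Lc (fine Lc M') (fun k => rs (k + 1)) (fun k => toSite_mem_range (hrs (k + 1))) n)
    {τ₂ : Matrix (Res (toSite (rs 0)) Lc M') (↥(pbox M') × Fin (d + 1)) ℝ} (hτ₂ : τ₂ = combF Lc M' (rs 0))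
    {Q₂₀ : Matrix κ (↥(pbox M') × Fin (d + 1)) ℝ}
    (hQ₂₀ : Q₂₀ = (perF M' (bhKStepAt d (toSite (rs 0)) Lc (lev 0))).submatrix (fun a : κ => ((pμ' a, Sum.inr (mμ' a)) : Idx M' (Fib d)))
        (fun b : ↥(pbox M') × Fin (d + 1) => ((b.1, Sum.inl b.2) : Idx M' (Fib d))))
    {Dbar : Matrix (↥(pbox M') × Fin (d + 1)) (Res (toSite (rs 0)) Lc M') ℝ}
    (hDbar : Dbar = (∏ i ∈ range (n + 1), (stepScale d Lc (lev (i + 1)) * ((box (d + 1) Lc).card : ℝ))) •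
        (tgrad M').submatrix (fun a : ↥(pbox M') × Fin (d + 1) => ((a.1, Sum.inl a.2) : Idx M' (Fib d))) (fun t : Res (toSite (rs 0)) Lc M' => (t.1 : ↥(pbox M'))))
    (hbar : κ → ℝ)
    {v : ↥(pbox M') × Fin (d + 1) → ℝ} (hv : v = minOp (effForm H₀ (fromRows Q₁₀ τ₁)).toBlocks₁₁ (fromRows Q₂₀ τ₂) *ᵥ Sum.elim hbar 0)
    {h : ↥(pbox (towerTorus Lc M' (n + 1))) × Fin (d + 1) → ℝ} (hh : h = minOp H₀ (fromRows Q₁₀ τ₁) *ᵥ Sum.elim v 0)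
    (c : ℝ)
    {Db₁ : Matrix (↥(pbox M') × Fin (d + 1)) (Res (toSite (rs 0)) Lc M') ℝ}
    (hDb₁ : Db₁ = Matrix.of fun (a : ↥(pbox M') × Fin (d + 1)) (t : Res (toSite (rs 0)) Lc M') =>
        -(c * (compRows Lc M' lev rs (n + 1) *ᵥ h) a * tdelta M' ((a.1 : Site (d + 1)) + unitVec a.2) t.1))
    {Db₂ : Matrix (↥(pbox M') × Fin (d + 1)) (Res (toSite (rs 0)) Lc M') ℝ}
    (hDb₂ : Db₂ = Matrix.of fun (a : ↥(pbox M') × Fin (d + 1)) (t : Res (toSite (rs 0)) Lc M') =>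
        (c ^ 2 * (∏ i ∈ range (n + 1), (stepScale d Lc (lev (i + 1)) * ((box (d + 1) Lc).card : ℝ)))⁻¹)
          * ((compRows Lc M' lev rs (n + 1) *ᵥ h) a) ^ 2 * tdelta M' ((a.1 : Site (d + 1)) + unitVec a.2) t.1) :
    secondVar (τ₂ * Dbar) (τ₂ * Db₁) (τ₂ * Db₂) = 0 := by
  obtain ⟨h₁, h₂, -⟩ := torus_kkt_nondeg_tower M' Lc lev rs n hrs hlev hM' pμ' mμ' hfμ' hcoarse' hH₀ hQ₁₀ hτ₁ hτ₂ hQ₂₀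
  exact torus_uTop_tower_of_c2_letter_nested_column M' Lc lev rs n hrs hM' hτ₂ hDbar H₀ τ₁ (effForm H₀ (fromRows Q₁₀ τ₁)).toBlocks₁₁ Q₂₀ hQ₁₀ h₁ h₂
    hbar hv hh c hDb₁ hDb₂

end Summit.QuantumFields.BalabanUV.Beta.FP.NestedDeadRowsOrderTwoTowerClosed

end
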